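import Mathlib
import Summits.ValiantsHypothesis.ValiantsHypothesis.Theorems.RigidityForcesSymmetryRankRigidMinimalReprLaplaceFourDefs
import Summits.ValiantsHypothesis.ValiantsHypothesis.Theorems.RigidityForcesSymmetryRankRigidMinimalReprLaplaceFourContraction
import Summits.ValiantsHypothesis.ValiantsHypothesis.Theorems.RigidityForcesSymmetryRankRigidMinimalReprLaplaceFourLineCore
import Summits.ValiantsHypothesis.ValiantsHypothesis.Theorems.RigidityForcesSymmetryRankRigidMinimalReprLaplaceFourLineKills
import Summits.ValiantsHypothesis.ValiantsHypothesis.Theorems.RigidityForcesSymmetryRankRigidMinimalReprLaplaceFourMatchShape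

/-!
# LINE profiles with one `02|13` and one `03|12` pair term: array form, stage A, the star, the matching
# (crux `RankRigidMinimalRepr`, stmt-ValiantsHypothesis-18034, route `RigidityForcesSymmetry`)

Shared machinery for the last two LINE profiles of `LaplaceOptimal 4`, `(3,1,1)` and `slice+(2,1,1)`, whose rank-one
part is `b(v₀,v₂)b′(v₁,v₃) + c(v₀,v₃)c′(v₁,v₂)` with explicit coefficient ARRAYS `b, b′, c, c′ : Fin 4 → Fin 4 → ℂ`:

* `contract_pair01/02/03`, `contract_slice0` — contractions of array terms in closed form;
* `e3_core` — stage A (`line_core`) for such data: a line family `d` with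
  `Q(lineVec d φ, φ) = (Bψ)(B′φ)ᵀ + (C′φ)(Cψ)ᵀ`, `ψ = lineVec d φ`, for all `φ`;
* `e3_star` — along the star at `0` this is impossible (`star_kill`: both columns are affine in `φ`);
* `e3_matching` — along the matching `(0,1)` the arrays have the normal form of `matching_shape`.
Letter relabellings act on array terms by composing the arrays (`letterPerm_pair02` …), which is how the profile files
move `d` to the canonical position.

HONEST FRAMING: finite algebra toward `LaplaceOptimal 4` (rung `TiedTorusBound 3`); the crux stays OPEN; nothing here
bears on `VP ≠ VNP`.
-/

set_option autoImplicit false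

-- the mandated summit-side namespace repeats a component by design (single-problem summit)
set_option linter.dupNamespace false

namespace Summit.ValiantsHypothesis.ValiantsHypothesis.Theorems.RigidityForcesSymmetryRankRigidMinimalRepr

namespace LaplaceFourLine

open Matrix LaplaceFourContraction

/-! ### §1 Array terms -/

/-- Contraction of a pair term on `01|23` given by arrays. -/
theorem contract_pair01 (g h : Fin 4 → Fin 4 → ℂ) (ψ φ : Fin 4 → ℂ) :
    contract₀₁ (fun v => g (v 0) (v 1) * h (v 2) (v 3)) ψ φ = (∑ x, ∑ y, ψ x * φ y * g x y) • Matrix.of h := by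
  ext i j
  simp only [contract₀₁, Matrix.of_apply, Matrix.smul_apply, smul_eq_mul, Matrix.cons_val_zero, Matrix.cons_val_one,
    Matrix.head_cons, Matrix.cons_val_two, Matrix.tail_cons, Matrix.cons_val_three, Finset.sum_mul]
  exact Finset.sum_congr rfl fun x _ => Finset.sum_congr rfl fun y _ => by ring

/-- Contraction of a pair term on `02|13` given by arrays: `(Bψ)(B′φ)ᵀ`. -/
theorem contract_pair02 (b b' : Fin 4 → Fin 4 → ℂ) (ψ φ : Fin 4 → ℂ) :
    contract₀₁ (fun v => b (v 0) (v 2) * b' (v 1) (v 3)) ψ φ =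
      vecMulVec (fun i => ∑ x, ψ x * b x i) (fun j => ∑ y, φ y * b' y j) := by
  ext i j
  simp only [contract₀₁, Matrix.of_apply, vecMulVec_apply, Matrix.cons_val_zero, Matrix.cons_val_one,
    Matrix.head_cons, Matrix.cons_val_two, Matrix.tail_cons, Matrix.cons_val_three, Finset.sum_mul_sum]
  exact Finset.sum_congr rfl fun x _ => Finset.sum_congr rfl fun y _ => by ring

/-- Contraction of a pair term on `03|12` given by arrays: `(C′φ)(Cψ)ᵀ`. -/
theorem contract_pair03 (c c' : Fin 4 → Fin 4 → ℂ) (ψ φ : Fin 4 → ℂ) :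
    contract₀₁ (fun v => c (v 0) (v 3) * c' (v 1) (v 2)) ψ φ =
      vecMulVec (fun i => ∑ y, φ y * c' y i) (fun j => ∑ x, ψ x * c x j) := by
  ext i j
  simp only [contract₀₁, Matrix.of_apply, vecMulVec_apply, Matrix.cons_val_zero, Matrix.cons_val_one,
    Matrix.head_cons, Matrix.cons_val_two, Matrix.tail_cons, Matrix.cons_val_three, Finset.sum_mul_sum]
  rw [Finset.sum_comm]
  exact Finset.sum_congr rfl fun y _ => Finset.sum_congr rfl fun x _ => by ring

/-- Contraction of a slice at slot `0` given by arrays. -/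
theorem contract_slice0 (f : Fin 4 → ℂ) (H : Fin 4 → Fin 4 → Fin 4 → ℂ) (ψ φ : Fin 4 → ℂ) :
    contract₀₁ (fun v => f (v 0) * H (v 1) (v 2) (v 3)) ψ φ =
      (∑ x, f x * ψ x) • Matrix.of fun i j => ∑ y, φ y * H y i j := by
  ext i j
  simp only [contract₀₁, Matrix.of_apply, Matrix.smul_apply, smul_eq_mul, Matrix.cons_val_zero, Matrix.cons_val_one,
    Matrix.head_cons, Matrix.cons_val_two, Matrix.tail_cons, Matrix.cons_val_three, Finset.sum_mul_sum]
  exact Finset.sum_congr rfl fun x _ => Finset.sum_congr rfl fun y _ => by ring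

/-- Array terms are split terms. -/
theorem isSplitTerm_pair01 (g h : Fin 4 → Fin 4 → ℂ) : IsSplitTerm {0, 1} (fun v => g (v 0) (v 1) * h (v 2) (v 3)) :=
  ⟨fun v => g (v 0) (v 1), fun v => h (v 2) (v 3),
    fun v v' hv => by show g (v 0) (v 1) = g (v' 0) (v' 1); rw [hv 0 (by simp), hv 1 (by simp)],
    fun v v' hv => by show h (v 2) (v 3) = h (v' 2) (v' 3); rw [hv 2 (by simp), hv 3 (by simp)], fun _ => rfl⟩

/-- Array terms are split terms. -/
theorem isSplitTerm_pair02 (b b' : Fin 4 → Fin 4 → ℂ) :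
    IsSplitTerm {0, 2} (fun v => b (v 0) (v 2) * b' (v 1) (v 3)) :=
  ⟨fun v => b (v 0) (v 2), fun v => b' (v 1) (v 3),
    fun v v' hv => by show b (v 0) (v 2) = b (v' 0) (v' 2); rw [hv 0 (by simp), hv 2 (by simp)],
    fun v v' hv => by show b' (v 1) (v 3) = b' (v' 1) (v' 3); rw [hv 1 (by simp), hv 3 (by simp)], fun _ => rfl⟩

/-- Array terms are split terms. -/
theorem isSplitTerm_pair03 (c c' : Fin 4 → Fin 4 → ℂ) :
    IsSplitTerm {0, 3} (fun v => c (v 0) (v 3) * c' (v 1) (v 2)) :=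
  ⟨fun v => c (v 0) (v 3), fun v => c' (v 1) (v 2),
    fun v v' hv => by show c (v 0) (v 3) = c (v' 0) (v' 3); rw [hv 0 (by simp), hv 3 (by simp)],
    fun v v' hv => by show c' (v 1) (v 2) = c' (v' 1) (v' 2); rw [hv 1 (by simp), hv 2 (by simp)], fun _ => rfl⟩

/-- Array terms are split terms. -/
theorem isSplitTerm_slice0 (f : Fin 4 → ℂ) (H : Fin 4 → Fin 4 → Fin 4 → ℂ) :
    IsSplitTerm {0} (fun v => f (v 0) * H (v 1) (v 2) (v 3)) :=
  ⟨fun v => f (v 0), fun v => H (v 1) (v 2) (v 3),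
    fun v v' hv => by show f (v 0) = f (v' 0); rw [hv 0 (by simp)],
    fun v v' hv => by
      show H (v 1) (v 2) (v 3) = H (v' 1) (v' 2) (v' 3); rw [hv 1 (by simp), hv 2 (by simp), hv 3 (by simp)],
    fun _ => rfl⟩

/-! ### §2 Stage A and the two endings for the `02|13 + 03|12` rank-one part -/

/-- **Stage A for the `ψ|φ + φ|ψ` profiles.**  A decomposition in canonical position with at most three noise terms
and rank-one part `b(v₀,v₂)b′(v₁,v₃) + c(v₀,v₃)c′(v₁,v₂)` admits a line family `d` along which, for every `φ`,
`Q(ψ,φ) = (Bψ)(B′φ)ᵀ + (C′φ)(Cψ)ᵀ` with `ψ = lineVec d φ` (and the noise contraction vanishes). -/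
theorem e3_core {ι : Type*} (N : Finset ι) (Xn : ι → (Fin 4 → Fin 4) → ℂ) (Sn : ι → Finset (Fin 4))
    (hXn : ∀ t ∈ N, IsSplitTerm (Sn t) (Xn t)) (hSn : ∀ t ∈ N, Sn t = {0} ∨ Sn t = {0, 1}) (hN : N.card ≤ 3)
    (b b' c c' : Fin 4 → Fin 4 → ℂ)
    (hsum : ∀ v, permPattern₄ v = (∑ t ∈ N, Xn t v) + b (v 0) (v 2) * b' (v 1) (v 3) + c (v 0) (v 3) * c' (v 1) (v 2)) :
    ∃ d : Fin 4 ⊕ (Fin 4 × Fin 4), (∀ p, d = Sum.inr p → p.1 ≠ p.2) ∧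
      (∀ φ : Fin 4 → ℂ, ∑ t ∈ N, contract₀₁ (Xn t) (lineVec d φ) φ = 0) ∧
      ∀ φ : Fin 4 → ℂ, contract₀₁ permPattern₄ (lineVec d φ) φ =
        vecMulVec (fun i => ∑ x, lineVec d φ x * b x i) (fun j => ∑ y, φ y * b' y j) +
        vecMulVec (fun i => ∑ y, φ y * c' y i) (fun j => ∑ x, lineVec d φ x * c x j) := by
  classical
  -- the full family on `ι ⊕ Fin 2`
  let X : ι ⊕ Fin 2 → (Fin 4 → Fin 4) → ℂ := fun s => match s with
    | Sum.inl t => Xn t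
    | Sum.inr k => if k = 0 then (fun v => b (v 0) (v 2) * b' (v 1) (v 3)) else fun v => c (v 0) (v 3) * c' (v 1) (v 2)
  let S : ι ⊕ Fin 2 → Finset (Fin 4) := fun s => match s with
    | Sum.inl t => Sn t
    | Sum.inr k => if k = 0 then {0, 2} else {0, 3}
  let T : Finset (ι ⊕ Fin 2) := N.disjSum Finset.univ
  have hX : ∀ s ∈ T, IsSplitTerm (S s) (X s) := by
    rintro (t | k) hs
    · simp only [T, Finset.inl_mem_disjSum] at hs; exact hXn t hs
    · fin_cases k
      · exact isSplitTerm_pair02 b b'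
      · exact isSplitTerm_pair03 c c'
  have hS : ∀ s ∈ T, S s = {0} ∨ S s = {0, 1} ∨ S s = {0, 2} ∨ S s = {0, 3} ∨ S s = {2} := by
    rintro (t | k) hs
    · simp only [T, Finset.inl_mem_disjSum] at hs; have := hSn t hs; simp only [S]; tauto
    · fin_cases k <;> simp [S]
  have hsum' : ∀ v, permPattern₄ v = ∑ s ∈ T, X s v := by
    intro v; rw [hsum v, Finset.sum_disjSum, Fin.sum_univ_two]; simp [X, add_assoc]
  have h02 : ¬(({0, 2} : Finset (Fin 4)) = {0} ∨ ({0, 2} : Finset (Fin 4)) = {0, 1}) := by decide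
  have h03 : ¬(({0, 3} : Finset (Fin 4)) = {0} ∨ ({0, 3} : Finset (Fin 4)) = {0, 1}) := by decide
  have hNf : T.filter (fun s => S s = {0} ∨ S s = {0, 1}) = N.disjSum ∅ := by
    ext s; rcases s with t | k
    · simp only [Finset.mem_filter, T, Finset.inl_mem_disjSum, S]
      exact ⟨fun h => h.1, fun h => ⟨h, hSn t h⟩⟩
    · simp only [Finset.mem_filter, T, Finset.inr_mem_disjSum, Finset.mem_univ, true_and, Finset.notMem_empty,
        iff_false, S]
      fin_cases k
      · simpa using h02
      · simpa using h03
  have hRf : T.filter (fun s => ¬(S s = {0} ∨ S s = {0, 1})) = (∅ : Finset ι).disjSum Finset.univ := by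
    ext s; rcases s with t | k
    · simp only [Finset.mem_filter, T, Finset.inl_mem_disjSum, S, Finset.notMem_empty, iff_false, not_and,
        not_not]
      exact fun h => hSn t h
    · simp only [Finset.mem_filter, T, Finset.inr_mem_disjSum, Finset.mem_univ, true_and, S, iff_true]
      fin_cases k
      · simpa using h02
      · simpa using h03
  have hNcard : (T.filter (fun s => S s = {0} ∨ S s = {0, 1})).card ≤ 3 := by
    rw [hNf, Finset.card_disjSum]; simpa using hN
  have hRcard : (T.filter (fun s => ¬(S s = {0} ∨ S s = {0, 1}))).card ≤ 2 := by
    rw [hRf, Finset.card_disjSum]; simp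
  obtain ⟨d, hd, hid⟩ := line_core T X S hX hS hsum' hNcard hRcard
  rw [hNf] at hid
  have hid' : ∀ φ : Fin 4 → ℂ, ∑ t ∈ N, contract₀₁ (Xn t) (lineVec d φ) φ = 0 := fun φ => by
    have := hid φ; rwa [Finset.sum_disjSum, Finset.sum_empty, add_zero] at this
  refine ⟨d, hd, hid', fun φ => ?_⟩
  rw [contract_congr hsum]
  have : (fun v => (∑ t ∈ N, Xn t v) + b (v 0) (v 2) * b' (v 1) (v 3) + c (v 0) (v 3) * c' (v 1) (v 2)) =
      fun v => ∑ k : Fin 3, (![fun v => ∑ t ∈ N, Xn t v, fun v => b (v 0) (v 2) * b' (v 1) (v 3),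
        fun v => c (v 0) (v 3) * c' (v 1) (v 2)] : Fin 3 → (Fin 4 → Fin 4) → ℂ) k v := by
    funext v; simp [Fin.sum_univ_three]
  rw [contract_congr (fun v => congrFun this v), contract_sum, Fin.sum_univ_three]
  simp only [Matrix.cons_val_zero, Matrix.cons_val_one, Matrix.head_cons, Matrix.cons_val_two, Matrix.tail_cons]
  rw [contract_sum, hid', zero_add, contract_pair02, contract_pair03]

/-- **The star ending.**  If `Q(ψ,φ) = (Bψ)(B′φ)ᵀ + (C′φ)(Cψ)ᵀ` along the star `ψ = (φ₀,-φ₁,-φ₂,-φ₃)` for all `φ`,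
contradiction (`star_kill`: both columns are linear in `φ`). -/
theorem e3_star (b b' c c' : Fin 4 → Fin 4 → ℂ)
    (h : ∀ φ : Fin 4 → ℂ, contract₀₁ permPattern₄ (lineVec (Sum.inl 0) φ) φ =
        vecMulVec (fun i => ∑ x, lineVec (Sum.inl 0) φ x * b x i) (fun j => ∑ y, φ y * b' y j) +
        vecMulVec (fun i => ∑ y, φ y * c' y i) (fun j => ∑ x, lineVec (Sum.inl 0) φ x * c x j)) : False := by
  refine star_kill (fun φ i => ∑ x, lineVec (Sum.inl 0) φ x * b x i) (fun φ i => ∑ y, φ y * c' y i)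
    (fun φ j => ∑ y, φ y * b' y j) (fun φ j => ∑ x, lineVec (Sum.inl 0) φ x * c x j) 0 0
    (fun x k => (![1, -1, -1, -1] : Fin 4 → ℂ) x * b x k) (fun x k => c' x k) (fun φ k => ?_) (fun φ k => ?_)
    fun φ _ => h φ
  · simp [lineVec_star, Fin.sum_univ_four]; ring
  · simp only [Pi.zero_apply, zero_add]; exact Finset.sum_congr rfl fun y _ => mul_comm _ _

/-- **The matching ending** is not a contradiction but the normal form (`matching_shape`). -/
theorem e3_matching (b b' c c' : Fin 4 → Fin 4 → ℂ)
    (h : ∀ φ : Fin 4 → ℂ, contract₀₁ permPattern₄ (lineVec (Sum.inr (0, 1)) φ) φ =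
        vecMulVec (fun i => ∑ x, lineVec (Sum.inr (0, 1)) φ x * b x i) (fun j => ∑ y, φ y * b' y j) +
        vecMulVec (fun i => ∑ y, φ y * c' y i) (fun j => ∑ x, lineVec (Sum.inr (0, 1)) φ x * c x j)) :
    (b 0 0 = 0 ∧ b 1 1 = 0 ∧ b 1 0 = b 0 1 ∧ b 0 2 = 0 ∧ b 0 3 = 0 ∧ b 1 2 = 0 ∧ b 1 3 = 0) ∧
    (c 0 0 = 0 ∧ c 1 1 = 0 ∧ c 1 0 = c 0 1 ∧ c 0 2 = 0 ∧ c 0 3 = 0 ∧ c 1 2 = 0 ∧ c 1 3 = 0) ∧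
    (b' 0 0 = 0 ∧ b' 1 1 = 0 ∧ b' 0 1 = -b' 1 0 ∧ b' 2 0 = 0 ∧ b' 3 0 = 0 ∧ b' 2 1 = 0 ∧ b' 3 1 = 0 ∧
      b' 0 2 = 0 ∧ b' 1 2 = 0 ∧ b' 2 2 = 0 ∧ b' 0 3 = 0 ∧ b' 1 3 = 0 ∧ b' 3 3 = 0 ∧ b' 3 2 = b' 2 3) ∧
    (c' 0 0 = 0 ∧ c' 1 1 = 0 ∧ c' 0 1 = -c' 1 0 ∧ c' 2 0 = 0 ∧ c' 3 0 = 0 ∧ c' 2 1 = 0 ∧ c' 3 1 = 0 ∧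
      c' 0 2 = 0 ∧ c' 1 2 = 0 ∧ c' 2 2 = 0 ∧ c' 0 3 = 0 ∧ c' 1 3 = 0 ∧ c' 3 3 = 0 ∧ c' 3 2 = c' 2 3) ∧
    (b 0 1 * b' 2 3 = 1 ∧ c 0 1 * c' 2 3 = 1 ∧ b 0 1 * b' 1 0 + c 0 1 * c' 1 0 = 0) :=
  matching_shape b b' c c' fun φ _ => h φ

/-! ### §3 Letter relabelling of array data -/

/-- Relabelling the letters of a `01|23` array term. -/
theorem letterPerm_pair01 (π : Equiv.Perm (Fin 4)) (g h : Fin 4 → Fin 4 → ℂ) :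
    letterPerm π (fun v => g (v 0) (v 1) * h (v 2) (v 3)) =
      fun v => g (π (v 0)) (π (v 1)) * h (π (v 2)) (π (v 3)) := rfl

/-- Relabelling the letters of a `02|13` array term. -/
theorem letterPerm_pair02 (π : Equiv.Perm (Fin 4)) (b b' : Fin 4 → Fin 4 → ℂ) :
    letterPerm π (fun v => b (v 0) (v 2) * b' (v 1) (v 3)) =
      fun v => b (π (v 0)) (π (v 2)) * b' (π (v 1)) (π (v 3)) := rfl

/-- Relabelling the letters of a `03|12` array term. -/
theorem letterPerm_pair03 (π : Equiv.Perm (Fin 4)) (c c' : Fin 4 → Fin 4 → ℂ) :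
    letterPerm π (fun v => c (v 0) (v 3) * c' (v 1) (v 2)) =
      fun v => c (π (v 0)) (π (v 3)) * c' (π (v 1)) (π (v 2)) := rfl

/-- Relabelling the letters of a slice at slot `0`. -/
theorem letterPerm_slice0 (π : Equiv.Perm (Fin 4)) (f : Fin 4 → ℂ) (H : Fin 4 → Fin 4 → Fin 4 → ℂ) :
    letterPerm π (fun v => f (v 0) * H (v 1) (v 2) (v 3)) =
      fun v => f (π (v 0)) * H (π (v 1)) (π (v 2)) (π (v 3)) := rfl

/-- Relabelling a decomposition of the array type: the relabelled arrays again decompose the pattern. -/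
theorem hsum_letterPerm {ι : Type*} (π : Equiv.Perm (Fin 4)) (N : Finset ι) (Xn : ι → (Fin 4 → Fin 4) → ℂ)
    (b b' c c' : Fin 4 → Fin 4 → ℂ)
    (hsum : ∀ v, permPattern₄ v = (∑ t ∈ N, Xn t v) + b (v 0) (v 2) * b' (v 1) (v 3) + c (v 0) (v 3) * c' (v 1) (v 2)) :
    ∀ v, permPattern₄ v = (∑ t ∈ N, letterPerm π (Xn t) v) +
      (fun x z => b (π x) (π z)) (v 0) (v 2) * (fun y w => b' (π y) (π w)) (v 1) (v 3) +
      (fun x w => c (π x) (π w)) (v 0) (v 3) * (fun y z => c' (π y) (π z)) (v 1) (v 2) := by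
  intro v
  have := congrFun (letterPerm_permPattern π) v
  rw [← this]
  simp only [letterPerm, hsum, Function.comp_apply]

end LaplaceFourLine

end Summit.ValiantsHypothesis.ValiantsHypothesis.Theorems.RigidityForcesSymmetryRankRigidMinimalRepr
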